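import Summits.QuantumFields.BalabanUV.Beta.GAN24.FaceDatumMultiplierResponse
import Summits.QuantumFields.BalabanUV.Beta.GAN24.DressedStepFaceCharges

/-!
# `BalabanUV.Beta.GAN24.CoordinateProfileResponses` — binder row G-an2-4 ∕ (CONV-C), W-slot CT-W, conservation law (C)∕(C)sym AT ALL LEVELS, the CLASS-STABILITY LETTER (I2) of this
# lineage's note `HOME/b2b-balaban-gan24-formalise-leaf-04/g68/EXIT-FACE-CURRENT-TOWER.md` §2∕§5 (T5.2): **THE LEG DATA «constant + lattice gradient of a bounded single-coordinate function»
# `ρ(w) = c + (Φ(w_β + 1) − Φ(w_β))` ON THE `β`-BONDS ARE ADMISSIBLE AT EVERY LEVEL `j` — (ii) THEIR MULTIPLIER RESPONSE UNDER THE DRESSED STEP KERNEL `G_j` VANISHES, AND (iii) THEIR FIELD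
# RESPONSE `H_ρ(κ″, q) = Σ'_w ρ(w)·colH G_j Lc β w κ″ q` IS AGAIN OF THE SAME FORM ONE LEVEL DOWN: `𝟙[κ″ = β]·(c′ + (Ψ(q_β + 1) − Ψ(q_β)))` WITH AN EXPLICIT BOUNDED `Ψ`**
# (`c′ = c·(Lc^{j+1})^{−(d+2)}`, `Ψ(n) = −c·Lc·(Lc^{j+1})^{−(d+2)}·Lc⁻¹·(n mod Lc) + cH_j·Φ(n div Lc)`).  This is the hereditary hypothesis of the (D)-tower induction: the exit-face datum
# `𝟙{w_β ≡ −1 (Lc)} = Lc⁻¹ − Lc⁻¹·d(· mod Lc)` is in the class, and so are all its descendants.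

NOT IN PRINT; OUR BOOKKEEPING ([folklore] `tsum` bookkeeping BY NAME over an2∕leaf-02's `DressedStepFaceCharges.hasSum_dressedStep_col` (the constant-datum field response = the sharp face
profile), 26 `VHWordsZeroBorder.hasSum_dressedStep_mm_col` (constant-datum multiplier response = 0), road-p2's `CoarseGaugeSourceResponse.tsum_coordGrad_colH ∕ sum_tsum_coarseGrad_colM`
(single-coordinate gradient data: field response = lifted gradient on the exit face, multiplier response = 0), this lineage's `FaceDatumMultiplierResponse.sawtooth_step`, road-p2's
`SymLinKernelFaceSupport.int_ediv_add_one`; G-an2-4 formalisation swarm, leaf prover `b2b-balaban-gan24-formalise-leaf-04`, gen 68).  HONEST FRAMING (cell contract, verbatim): «discharging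
`BetaPertH` makes Bałaban's UV stability UNCONDITIONAL — a real constructive-QFT result; it is NOT the continuum limit and NOT the Clay problem.»  HONEST DEPENDENCY (verbatim): «continuum YM
on T⁴ ⇐ BetaPertH ∧ nine spine estimates (0/9 proved); BetaPertH ⇐ (D1) ∧ (D4) ∧ CAP+tail; G-an2-4 gates asym, D1 and NE2/3/4.»

WHAT ([folklore]; generic `d`, `[NeZero Lc]`, in-block root `r ∈ box Lc`, every `j`, raw units, `G_j := coDressKBmAt (toSite r) Lc (KInvStep Lc j)`, bounded `Φ : ℤ → ℝ`; 0 `def`, 0 cited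
facts, 0 `def … : Prop`, 0 sorry): §1 `summable_abs_dressed_entry_coarse` (a coarse second-leg entry family of `G_j` is absolutely summable), `tsum_coordGrad_mul_dressed_mm_eq_zero`
(`Σ'_w (Φ(w_β+1) − Φ(w_β))·G_j q (Lc•w)(inr m)(inr β) = 0`), **`tsum_profile_mul_dressed_mm_eq_zero`** (`Σ'_w (c + (Φ(w_β+1) − Φ(w_β)))·G_j q (Lc•w)(inr m)(inr β) = 0` — admissibility (ii));
§2 **`tsum_profile_mul_colH`** (`Σ'_w (c + (Φ(w_β+1) − Φ(w_β)))·colH G_j Lc β w κ″ q = 𝟙[κ″ = β ∧ q_β mod Lc = Lc−1]·(c·Lc·(Lc^{j+1})^{−(d+2)} + cH_j·(Φ(q_β div Lc + 1) − Φ(q_β div Lc)))`);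
§3 `face_mul_eq_const_add_grad` (for every `n : ℤ`: `𝟙[n mod Lc = Lc−1]·(A + cH·(Φ(n div Lc + 1) − Φ(n div Lc))) = A·Lc⁻¹ + (Ψ(n+1) − Ψ(n))`, `Ψ(n) := −A·Lc⁻¹·(n mod Lc) + cH·Φ(n div Lc)`),
`abs_Psi_le` (`|Ψ n| ≤ |A| + |cH|·B`), and the packaged heredity **`tsum_profile_mul_colH_eq_const_add_grad`** (the field response IS `𝟙[κ″ = β]·(c′ + (Ψ(q_β+1) − Ψ(q_β)))`).  Asserts NO
value of Bałaban's tables; discharges NOTHING of (C)sym ∕ (Q-D) ∕ (Q-D-rate) ∕ «T2Shape» ∕ «T2Drift» ∕ (hW, hWall); NEVER «G-an2-4 closed» as (CONV-C); NOT D1, NOT `BetaPertH`, NOT continuum,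
NOT Clay.  2026-08-23; no existing file touched.
-/

noncomputable section

open Finset
open scoped BigOperators
open Literature.MathematicalPhysics.QuantumFieldTheory
open Literature.MathematicalPhysics.QuantumFieldTheory.Balaban1983to89
open Literature.MathematicalPhysics.QuantumFieldTheory.Balaban1983to89.Beta
open ExpKernelCalculus (Site MKer)
open AffineAveraging (box toSite)
open AveragingContours (blk)
open B6BondElimination (unitVec unitVec_apply)
open Literature.Probability.LatticeModels (Torus.proj)
open OneStepResolventKernel (Fib eq_zsmul_quo_of_proj)
open LatticeForm (quo)
open OneStepKernelFamily (KInvStep colH)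
open SecondOrderResponse (colM)
open Summit.QuantumFields.BalabanUV.Beta.BorderedHessian (stepScale)
open Summit.QuantumFields.BalabanUV.Beta.AxialDressingRooted (coDressKBmAt decays_coDressKBmAt_KInvStep)
open Summit.QuantumFields.BalabanUV.Beta.HessKerDressedUnits (unitK unitK_one)
open Summit.QuantumFields.BalabanUV.Beta.KernelWardResponse (coDressKBmAt_KInvStep_inr_inr_off)
open Summit.QuantumFields.BalabanUV.Beta.GAN24.ResolventLegCharges (summable_exp_coarse')
open Summit.QuantumFields.BalabanUV.Beta.GAN24.CoarseGaugeSourceResponse (sum_tsum_coarseGrad_colM tsum_coordGrad_colH)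
open Summit.QuantumFields.BalabanUV.Beta.GAN24.VHWordsZeroBorder (hasSum_dressedStep_mm_col)
open Summit.QuantumFields.BalabanUV.Beta.GAN24.DressedStepFaceCharges (hasSum_dressedStep_col)
open Summit.QuantumFields.BalabanUV.Beta.GAN24.FaceDatumMultiplierResponse (sawtooth_step)
open Summit.QuantumFields.BalabanUV.Beta.GAN24.SymLinKernelFaceSupport (int_ediv_add_one)

namespace Summit.QuantumFields.BalabanUV.Beta.GAN24.CoordinateProfileResponses

variable {d : ℕ} {Lc : ℕ} [NeZero Lc] {r : Fin (d + 1) → ℕ}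

/-! ## §1 Admissibility (ii): zero multiplier response -/

/-- [folklore] A coarse-second-leg entry family `w ↦ G_j q (Lc•w) a b` of the dressed step kernel is absolutely summable. -/
theorem summable_abs_dressed_entry_coarse (hr : r ∈ box (d + 1) Lc) (j : ℕ) (q : Site (d + 1)) (a b : Fib d) :
    Summable fun w : Site (d + 1) => |coDressKBmAt (toSite r) Lc (KInvStep (d := d) Lc j) q ((Lc : ℤ) • w) a b| := by
  have hLc : 1 ≤ Lc := Nat.one_le_iff_ne_zero.mpr (NeZero.ne Lc)
  obtain ⟨δ, C, hδ, _, hK⟩ := decays_coDressKBmAt_KInvStep (d := d) hr j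
  exact Summable.of_nonneg_of_le (fun _ => abs_nonneg _) (fun w => hK q _ a b) ((summable_exp_coarse' (d := d) hLc hδ q).mul_left C)

/-- [folklore] Bounded weight × absolutely summable entry family is summable. -/
theorem summable_bdd_mul_dressed_entry_coarse (hr : r ∈ box (d + 1) Lc) (j : ℕ) (q : Site (d + 1)) (a b : Fib d) {ρ : Site (d + 1) → ℝ} {B : ℝ} (hρ : ∀ w, |ρ w| ≤ B) :
    Summable fun w : Site (d + 1) => ρ w * coDressKBmAt (toSite r) Lc (KInvStep (d := d) Lc j) q ((Lc : ℤ) • w) a b := by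
  have hB : 0 ≤ B := (abs_nonneg _).trans (hρ 0)
  refine Summable.of_norm_bounded ((summable_abs_dressed_entry_coarse hr j q a b).mul_left B) (fun w => ?_)
  rw [Real.norm_eq_abs, abs_mul]
  exact mul_le_mul_of_nonneg_right (hρ w) (abs_nonneg _)

/-- [folklore] **THE MULTIPLIER RESPONSE TO A SINGLE-COORDINATE GRADIENT DATUM VANISHES**: `Σ'_w (Φ(w_β+1) − Φ(w_β))·G_j q (Lc•w)(inr m)(inr β) = 0` (bounded `Φ`; coarse `q` by road-p2's
`sum_tsum_coarseGrad_colM`, off-coarse `q` by `KInvStep_inr_off`). -/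
theorem tsum_coordGrad_mul_dressed_mm_eq_zero (j : ℕ) (β m : Fin (d + 1)) (Φ : ℤ → ℝ) {B : ℝ} (hΦ : ∀ s, |Φ s| ≤ B) (q : Site (d + 1)) :
    ∑' w : Site (d + 1), (Φ (w β + 1) - Φ (w β)) * coDressKBmAt (toSite r) Lc (KInvStep (d := d) Lc j) q ((Lc : ℤ) • w) (Sum.inr m) (Sum.inr β) = 0 := by
  by_cases hq : Torus.proj Lc q = 0
  · -- coarse first leg `q = Lc • v`
    have hqv := eq_zsmul_quo_of_proj (N := Lc) hq
    set φ : Site (d + 1) → ℝ := fun w => Φ (w β) with hφ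
    have hφb : ∀ w, |φ w| ≤ B := fun w => hΦ _
    have h := sum_tsum_coarseGrad_colM (Lc := Lc) (toSite r) j φ hφb m (quo Lc q)
    -- only `μ = β` survives
    rw [Finset.sum_eq_single β (fun μ _ hμ => ?_) (fun hb => absurd (Finset.mem_univ β) hb)] at h
    · have e : ∀ w : Site (d + 1), (Φ (w β + 1) - Φ (w β)) * coDressKBmAt (toSite r) Lc (KInvStep (d := d) Lc j) q ((Lc : ℤ) • w) (Sum.inr m) (Sum.inr β) =
          (φ (w + unitVec β) - φ w) * colM (coDressKBmAt (toSite r) Lc (KInvStep (d := d) Lc j)) Lc β w m (quo Lc q) := by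
        intro w
        have ew : (w + unitVec β) β = w β + 1 := by simp only [Pi.add_apply, unitVec_apply, if_true]
        simp only [hφ, ew, colM]
        rw [← hqv]
      rw [tsum_congr e, h]
    · have e0 : ∀ w : Site (d + 1), φ (w + unitVec μ) - φ w = 0 := by
        intro w
        simp only [hφ, Pi.add_apply, unitVec_apply, if_neg (Ne.symm hμ), add_zero, sub_self]
      simp only [e0, zero_mul, tsum_zero]
  · -- off the coarse lattice the mm block vanishes
    have e : ∀ w : Site (d + 1), coDressKBmAt (toSite r) Lc (KInvStep (d := d) Lc j) q ((Lc : ℤ) • w) (Sum.inr m) (Sum.inr β) = 0 := fun w =>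
      coDressKBmAt_KInvStep_inr_inr_off (toSite r) j q hq _ m β
    simp only [e, mul_zero, tsum_zero]

/-- [folklore] **ADMISSIBILITY (ii) — THE MULTIPLIER RESPONSE OF `G_j` TO A «CONSTANT + SINGLE-COORDINATE GRADIENT» LEG DATUM VANISHES**:
`Σ'_w (c + (Φ(w_β+1) − Φ(w_β)))·G_j q (Lc•w)(inr m)(inr β) = 0`. -/
theorem tsum_profile_mul_dressed_mm_eq_zero (hr : r ∈ box (d + 1) Lc) (j : ℕ) (β m : Fin (d + 1)) (c : ℝ) (Φ : ℤ → ℝ) {B : ℝ} (hΦ : ∀ s, |Φ s| ≤ B) (q : Site (d + 1)) :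
    ∑' w : Site (d + 1), (c + (Φ (w β + 1) - Φ (w β))) * coDressKBmAt (toSite r) Lc (KInvStep (d := d) Lc j) q ((Lc : ℤ) • w) (Sum.inr m) (Sum.inr β) = 0 := by
  have hLc : 1 ≤ Lc := Nat.one_le_iff_ne_zero.mpr (NeZero.ne Lc)
  have hB : 0 ≤ B := (abs_nonneg _).trans (hΦ 0)
  have h0 := hasSum_dressedStep_mm_col (d := d) hLc hr 1 1 j q β m
  rw [unitK_one] at h0
  have hs1 : Summable fun w : Site (d + 1) => c * coDressKBmAt (toSite r) Lc (KInvStep (d := d) Lc j) q ((Lc : ℤ) • w) (Sum.inr m) (Sum.inr β) :=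
    h0.summable.mul_left c
  have hs2 : Summable fun w : Site (d + 1) => (Φ (w β + 1) - Φ (w β)) * coDressKBmAt (toSite r) Lc (KInvStep (d := d) Lc j) q ((Lc : ℤ) • w) (Sum.inr m) (Sum.inr β) := by
    refine summable_bdd_mul_dressed_entry_coarse hr j q _ _ (B := B + B) (fun w => ?_)
    exact (abs_sub _ _).trans (add_le_add (hΦ _) (hΦ _))
  have e : ∀ w : Site (d + 1), (c + (Φ (w β + 1) - Φ (w β))) * coDressKBmAt (toSite r) Lc (KInvStep (d := d) Lc j) q ((Lc : ℤ) • w) (Sum.inr m) (Sum.inr β) =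
      c * coDressKBmAt (toSite r) Lc (KInvStep (d := d) Lc j) q ((Lc : ℤ) • w) (Sum.inr m) (Sum.inr β)
        + (Φ (w β + 1) - Φ (w β)) * coDressKBmAt (toSite r) Lc (KInvStep (d := d) Lc j) q ((Lc : ℤ) • w) (Sum.inr m) (Sum.inr β) := fun w => by ring
  rw [tsum_congr e, hs1.tsum_add hs2, tsum_mul_left, h0.tsum_eq, mul_zero, zero_add]
  exact tsum_coordGrad_mul_dressed_mm_eq_zero j β m Φ hΦ q

/-! ## §2 Admissibility (iii): the field response, explicitly -/

/-- [folklore] **THE FIELD RESPONSE OF `G_j` TO A «CONSTANT + SINGLE-COORDINATE GRADIENT» LEG DATUM** is supported on the level-`j` exit face of direction `β`, in direction `β` only: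
`Σ'_w (c + (Φ(w_β+1) − Φ(w_β)))·colH G_j Lc β w κ″ q = 𝟙[κ″ = β ∧ q_β mod Lc = Lc−1]·(c·Lc·(Lc^{j+1})^{−(d+2)} + cH_j·(Φ(q_β div Lc + 1) − Φ(q_β div Lc)))`. -/
theorem tsum_profile_mul_colH (hr : r ∈ box (d + 1) Lc) (j : ℕ) (β κ'' : Fin (d + 1)) (c : ℝ) (Φ : ℤ → ℝ) {B : ℝ} (hΦ : ∀ s, |Φ s| ≤ B) (q : Site (d + 1)) :
    ∑' w : Site (d + 1), (c + (Φ (w β + 1) - Φ (w β))) * colH (coDressKBmAt (toSite r) Lc (KInvStep (d := d) Lc j)) Lc β w κ'' q =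
      if κ'' = β ∧ q β % (Lc : ℤ) = (Lc : ℤ) - 1 then
        c * ((Lc : ℝ) * ((((Lc ^ (j + 1) : ℕ) : ℝ)) ^ (d + 1 + 1))⁻¹) + (stepScale d Lc j * (Lc : ℝ) ^ (d + 1))⁻¹ * (Φ (q β / (Lc : ℤ) + 1) - Φ (q β / (Lc : ℤ)))
      else 0 := by
  have hLc : 1 ≤ Lc := Nat.one_le_iff_ne_zero.mpr (NeZero.ne Lc)
  -- constant datum: the sharp face profile
  have h1 := hasSum_dressedStep_col (d := d) hLc hr 1 1 j β (Sum.inl κ'') q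
  rw [unitK_one] at h1
  simp only [Sum.elim_inl, mul_one] at h1
  -- gradient datum: the lifted gradient on the exit face
  have h2 := tsum_coordGrad_colH (d := d) hr j β Φ hΦ κ'' q
  have hs1 : Summable fun w : Site (d + 1) => c * colH (coDressKBmAt (toSite r) Lc (KInvStep (d := d) Lc j)) Lc β w κ'' q := h1.summable.mul_left c
  have hs2 : Summable fun w : Site (d + 1) => (Φ (w β + 1) - Φ (w β)) * colH (coDressKBmAt (toSite r) Lc (KInvStep (d := d) Lc j)) Lc β w κ'' q := by
    refine summable_bdd_mul_dressed_entry_coarse hr j q _ _ (B := B + B) (fun w => ?_)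
    exact (abs_sub _ _).trans (add_le_add (hΦ _) (hΦ _))
  have e : ∀ w : Site (d + 1), (c + (Φ (w β + 1) - Φ (w β))) * colH (coDressKBmAt (toSite r) Lc (KInvStep (d := d) Lc j)) Lc β w κ'' q =
      c * colH (coDressKBmAt (toSite r) Lc (KInvStep (d := d) Lc j)) Lc β w κ'' q
        + (Φ (w β + 1) - Φ (w β)) * colH (coDressKBmAt (toSite r) Lc (KInvStep (d := d) Lc j)) Lc β w κ'' q := fun w => by ring
  rw [tsum_congr e, hs1.tsum_add hs2, tsum_mul_left, h2]
  simp only [colH] at h1 ⊢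
  rw [h1.tsum_eq]
  simp only [AveragingContours.blk]
  by_cases hκ : κ'' = β
  · subst hκ
    by_cases hq : q κ'' % (Lc : ℤ) = (Lc : ℤ) - 1
    · simp only [hq, if_true, and_self]
    · simp only [hq, if_false, and_false, mul_zero, add_zero]
  · simp only [hκ, if_false, false_and, mul_zero, add_zero]
    split_ifs <;> simp

/-! ## §3 Heredity: the response is again «constant + single-coordinate gradient of a bounded function» -/

/-- [folklore] **THE FACE-SUPPORTED RESPONSE IS A CONSTANT PLUS A LATTICE GRADIENT**: for every `n : ℤ`,
`𝟙[n mod Lc = Lc−1]·(A + cH·(Φ(n div Lc + 1) − Φ(n div Lc))) = A·Lc⁻¹ + (Ψ(n+1) − Ψ(n))`, `Ψ(n) := −(A·Lc⁻¹)·(n mod Lc) + cH·Φ(n div Lc)`. -/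
theorem face_mul_eq_const_add_grad (A cH : ℝ) (Φ : ℤ → ℝ) (n : ℤ) :
    (if n % (Lc : ℤ) = (Lc : ℤ) - 1 then A + cH * (Φ (n / (Lc : ℤ) + 1) - Φ (n / (Lc : ℤ))) else 0) =
      A * (Lc : ℝ)⁻¹ +
        ((-(A * (Lc : ℝ)⁻¹) * ((((n + 1) % (Lc : ℤ) : ℤ) : ℝ)) + cH * Φ ((n + 1) / (Lc : ℤ)))
          - (-(A * (Lc : ℝ)⁻¹) * (((n % (Lc : ℤ) : ℤ) : ℝ)) + cH * Φ (n / (Lc : ℤ)))) := by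
  have hLc : 1 ≤ Lc := Nat.one_le_iff_ne_zero.mpr (NeZero.ne Lc)
  have hL0 : (Lc : ℝ) ≠ 0 := by exact_mod_cast NeZero.ne Lc
  have hs := sawtooth_step (Lc := Lc) hLc n
  rw [int_ediv_add_one hLc n]
  have e1 : (-(A * (Lc : ℝ)⁻¹) * ((((n + 1) % (Lc : ℤ) : ℤ) : ℝ)) + cH * Φ (n / (Lc : ℤ) + (if n % (Lc : ℤ) = (Lc : ℤ) - 1 then 1 else 0)))
      - (-(A * (Lc : ℝ)⁻¹) * (((n % (Lc : ℤ) : ℤ) : ℝ)) + cH * Φ (n / (Lc : ℤ))) =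
      -(A * (Lc : ℝ)⁻¹) * (((((n + 1) % (Lc : ℤ) : ℤ) : ℝ)) - (((n % (Lc : ℤ) : ℤ) : ℝ)))
        + cH * (Φ (n / (Lc : ℤ) + (if n % (Lc : ℤ) = (Lc : ℤ) - 1 then 1 else 0)) - Φ (n / (Lc : ℤ))) := by ring
  rw [e1, hs]
  split_ifs with h
  · field_simp
    ring
  · simp only [add_zero, sub_self, mul_zero, mul_one, sub_zero]
    field_simp
    ring

/-- [folklore] The primitive `Ψ` is bounded: `|Ψ n| ≤ |A| + |cH|·B`. -/
theorem abs_Psi_le (A cH : ℝ) (Φ : ℤ → ℝ) {B : ℝ} (hΦ : ∀ s, |Φ s| ≤ B) (n : ℤ) :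
    |-(A * (Lc : ℝ)⁻¹) * (((n % (Lc : ℤ) : ℤ) : ℝ)) + cH * Φ (n / (Lc : ℤ))| ≤ |A| + |cH| * B := by
  have hLc : 1 ≤ Lc := Nat.one_le_iff_ne_zero.mpr (NeZero.ne Lc)
  have hL : (0 : ℤ) < Lc := by exact_mod_cast hLc
  have hLr : (0 : ℝ) < Lc := by exact_mod_cast hL
  have hm0 : (0 : ℝ) ≤ (((n % (Lc : ℤ) : ℤ) : ℝ)) := by exact_mod_cast Int.emod_nonneg _ hL.ne'
  have hm1 : (((n % (Lc : ℤ) : ℤ) : ℝ)) ≤ (Lc : ℝ) := by exact_mod_cast (Int.emod_lt_of_pos n hL).le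
  refine (abs_add_le _ _).trans (add_le_add ?_ ?_)
  · rw [abs_mul, abs_neg, abs_mul, abs_inv, abs_of_pos hLr, abs_of_nonneg hm0]
    calc |A| * (Lc : ℝ)⁻¹ * (((n % (Lc : ℤ) : ℤ) : ℝ)) ≤ |A| * (Lc : ℝ)⁻¹ * (Lc : ℝ) := mul_le_mul_of_nonneg_left hm1 (by positivity)
      _ = |A| := by field_simp
  · rw [abs_mul]
    exact mul_le_mul_of_nonneg_left (hΦ _) (abs_nonneg _)

/-- [folklore] **HEREDITY, PACKAGED**: the field response of `G_j` to the leg datum `c + dΦ(·_β)` on the `β`-bonds is the leg datum `𝟙[κ″ = β]·(c′ + dΨ(·_β))` one level down,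
`c′ = c·Lc·(Lc^{j+1})^{−(d+2)}·Lc⁻¹`, `Ψ(n) = −(c·Lc·(Lc^{j+1})^{−(d+2)}·Lc⁻¹)·(n mod Lc) + cH_j·Φ(n div Lc)` (bounded by `abs_Psi_le`). -/
theorem tsum_profile_mul_colH_eq_const_add_grad (hr : r ∈ box (d + 1) Lc) (j : ℕ) (β κ'' : Fin (d + 1)) (c : ℝ) (Φ : ℤ → ℝ) {B : ℝ} (hΦ : ∀ s, |Φ s| ≤ B) (q : Site (d + 1)) :
    ∑' w : Site (d + 1), (c + (Φ (w β + 1) - Φ (w β))) * colH (coDressKBmAt (toSite r) Lc (KInvStep (d := d) Lc j)) Lc β w κ'' q =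
      if κ'' = β then
        (c * ((Lc : ℝ) * ((((Lc ^ (j + 1) : ℕ) : ℝ)) ^ (d + 1 + 1))⁻¹)) * (Lc : ℝ)⁻¹ +
          ((-((c * ((Lc : ℝ) * ((((Lc ^ (j + 1) : ℕ) : ℝ)) ^ (d + 1 + 1))⁻¹)) * (Lc : ℝ)⁻¹) * ((((q β + 1) % (Lc : ℤ) : ℤ) : ℝ))
              + (stepScale d Lc j * (Lc : ℝ) ^ (d + 1))⁻¹ * Φ ((q β + 1) / (Lc : ℤ)))
            - (-((c * ((Lc : ℝ) * ((((Lc ^ (j + 1) : ℕ) : ℝ)) ^ (d + 1 + 1))⁻¹)) * (Lc : ℝ)⁻¹) * (((q β % (Lc : ℤ) : ℤ) : ℝ))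
              + (stepScale d Lc j * (Lc : ℝ) ^ (d + 1))⁻¹ * Φ (q β / (Lc : ℤ))))
      else 0 := by
  rw [tsum_profile_mul_colH hr j β κ'' c Φ hΦ q]
  by_cases hκ : κ'' = β
  · simp only [hκ, true_and, if_true]
    exact face_mul_eq_const_add_grad (Lc := Lc) _ _ Φ (q β)
  · simp only [hκ, false_and, if_false]

end Summit.QuantumFields.BalabanUV.Beta.GAN24.CoordinateProfileResponses
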